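import Literature.NumberTheory.CubicFields.SingularZeroTransport
import Mathlib.Analysis.Complex.UpperHalfPlane.MoebiusAction
import Mathlib.Analysis.SpecialFunctions.Pow.Real
import HarnessLib

/-!
# The Hessian covariant of a binary cubic form: covariance, the syzygy, definiteness, and its root in `ℍ`

Topic `Literature/NumberTheory/CubicFields`; vocabulary of `BinaryCubicForms.lean` (`subst`, `disc`),
`MemUCriterion.lean` (`derivU`, `derivV`), `SingularZeroTransport.lean` (`rowMul`).

Davenport's reduction theory of binary cubic forms of POSITIVE discriminant (H. Davenport, *On the
class-number of binary cubic forms I*, J. London Math. Soc. 26 (1951); Bhargava–Shankar–Tsimerman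
2013 §5.1 use Gauss's fundamental domain in `GL₂(ℝ)` instead) rests on the Hessian
`H(u,v) = (b² − 3ac)u² + (bc − 9ad)uv + (c² − 3bd)v²`: it is a covariant of weight `2`
(`H(f ∘ γ) = (det γ)² · H(f) ∘ γ`), has discriminant `−3 Disc f`, and is therefore DEFINITE when
`Disc f > 0` — positive definite, by the classical syzygy `G² = 4H³ − 27 Disc·f²` (`G` the
Jacobian covariant). Its root in the upper half plane is a `GL₂(ℝ)`-equivariant map
`V⁽⁰⁾_ℝ → ℍ`, through which "`f` reduced" means "root of `H(f)` in the modular fundamental domain".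
This file PROVES:
* `hessP/hessQ/hessR`, `hessianEval`, `hessQ_sq_sub_four_mul` (`Q² − 4PR = −3 Disc`),
  `hessianEval_smul`, **`hessianEval_subst`** (covariance), `hessP_subst`;
* `jacobianEval`, **`jacobianEval_sq`** (the syzygy `G² = 4H³ − 27 Disc f²`),
  `four_mul_hessP_mul_hessianEval` (`4PH = (2Pu + Qv)² + 3 Disc v²`);
* over an ordered field: **`hessP_pos_of_disc_pos`**, **`hessianEval_pos_of_disc_pos`** (positive
  definiteness for `Disc > 0`);
* over `ℝ`: `hessianRoot f h ∈ ℍ` (the root `(−Q + i√(3 Disc))/(2P)`), `hessianQuadℂ_hessianRoot`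
  (it is a root), `eq_hessianRoot_of_root` (the unique one in `ℍ`), and **`smul_hessianRoot_subst`**:
  for `γ ∈ GL₂(ℝ)`, `γᵀ • hessianRoot (f ∘ γ) = hessianRoot f` for Mathlib's action of `GL(2, ℝ)` on
  `ℍ` (Möbius, composed with complex conjugation when `det γ < 0`).

## References

* H. Davenport, *On the class-number of binary cubic forms I*, J. London Math. Soc. 26 (1951)
  183–192 (reduction of forms of positive discriminant via the Hessian) [Davenport1951CubicFormsI].
* M. Bhargava, A. Shankar, J. Tsimerman, *On the Davenport–Heilbronn theorems and second order
  terms*, Invent. Math. 193 (2013) 439–499 = arXiv:1005.0672, §5.1 [BhargavaShankarTsimerman2012].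
-/

noncomputable section

open scoped MatrixGroups ComplexConjugate UpperHalfPlane

namespace Literature.NumberTheory.CubicFields

namespace BinaryCubic

/-! ### The Hessian and the Jacobian covariants (any commutative ring) -/

section CommRing

variable {R : Type*} [CommRing R] (f : BinaryCubic R)

/-- `P = b² − 3ac`, the `u²`-coefficient of the Hessian. [cite: BhargavaShankarTsimerman2012, §5.1 (reduction theory); Davenport 1951 I] -/
def hessP : R := f.b ^ 2 - 3 * f.a * f.c

/-- `Q = bc − 9ad`, the `uv`-coefficient of the Hessian. [folklore] -/
def hessQ : R := f.b * f.c - 9 * f.a * f.d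

/-- `R = c² − 3bd`, the `v²`-coefficient of the Hessian. [folklore] -/
def hessR : R := f.c ^ 2 - 3 * f.b * f.d

/-- **The Hessian covariant** `H(u,v) = P u² + Q uv + R v²` (`= −(f_{uu}f_{vv} − f_{uv}²)/36`). [folklore] -/
def hessianEval (u v : R) : R := f.hessP * u ^ 2 + f.hessQ * u * v + f.hessR * v ^ 2

/-- `H(1, 0) = P`. [folklore] -/
@[simp] theorem hessianEval_one_zero : f.hessianEval 1 0 = f.hessP := by
  simp [hessianEval]

/-- **`Disc(H) = −3 Disc(f)`**: `Q² − 4PR = −3 Disc`. [folklore] -/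
theorem hessQ_sq_sub_four_mul : f.hessQ ^ 2 - 4 * f.hessP * f.hessR = -3 * f.disc := by
  simp only [hessP, hessQ, hessR, disc_eq]; ring

/-- The Hessian is quadratic in `f`: `H(μf) = μ² H(f)`. [folklore] -/
theorem hessianEval_smul (μ u v : R) : (μ • f).hessianEval u v = μ ^ 2 * f.hessianEval u v := by
  simp only [hessianEval, hessP, hessQ, hessR, smul_a, smul_b, smul_c, smul_d]; ring

/-- **Covariance of the Hessian** (weight `2`): `H(f ∘ γ)(u,v) = (det γ)² · H(f)((u,v)γ)`. [cite: BhargavaShankarTsimerman2012, §5.1; Davenport 1951 I (the Hessian is a covariant)] -/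
theorem hessianEval_subst (γ : Matrix (Fin 2) (Fin 2) R) (u v : R) :
    (f.subst γ).hessianEval u v =
      γ.det ^ 2 * f.hessianEval (u * γ 0 0 + v * γ 1 0) (u * γ 0 1 + v * γ 1 1) := by
  simp only [hessianEval, hessP, hessQ, hessR, subst, Matrix.det_fin_two]; ring

/-- The leading coefficient of `H(f ∘ γ)` is `(det γ)² H(f)(γ₀₀, γ₀₁)`. [folklore] -/
theorem hessP_subst (γ : Matrix (Fin 2) (Fin 2) R) :
    (f.subst γ).hessP = γ.det ^ 2 * f.hessianEval (γ 0 0) (γ 0 1) := by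
  simpa using hessianEval_subst f γ 1 0

/-- **The Jacobian covariant** `G = f_u H_v − f_v H_u` (a cubic covariant of degree `3`). [folklore] -/
def jacobianEval (u v : R) : R :=
  f.derivU u v * (f.hessQ * u + 2 * f.hessR * v) - f.derivV u v * (2 * f.hessP * u + f.hessQ * v)

/-- **The syzygy of the binary cubic**: `G² = 4H³ − 27 Disc · f²` (Cayley). [folklore] -/
theorem jacobianEval_sq (u v : R) :
    f.jacobianEval u v ^ 2 = 4 * f.hessianEval u v ^ 3 - 27 * f.disc * f.eval u v ^ 2 := by
  simp only [jacobianEval, hessianEval, hessP, hessQ, hessR, derivU, derivV, eval, disc_eq]; ring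

/-- The syzygy at `(1, 0)`: `(3aQ − 2bP)² = 4P³ − 27 Disc · a²`. [folklore] -/
theorem syzygy_one_zero : (3 * f.a * f.hessQ - 2 * f.b * f.hessP) ^ 2 = 4 * f.hessP ^ 3 - 27 * f.disc * f.a ^ 2 := by
  simp only [hessP, hessQ, disc_eq]; ring

/-- Completing the square: `4P · H(u,v) = (2Pu + Qv)² + 3 Disc · v²`. [folklore] -/
theorem four_mul_hessP_mul_hessianEval (u v : R) :
    4 * f.hessP * f.hessianEval u v = (2 * f.hessP * u + f.hessQ * v) ^ 2 + 3 * f.disc * v ^ 2 := by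
  have h := f.hessQ_sq_sub_four_mul
  simp only [hessianEval]
  linear_combination (-(v ^ 2)) * h

/-- The Hessian commutes with change of ring. [folklore] -/
theorem hessianEval_map {S : Type*} [CommRing S] (φ : R →+* S) (u v : R) :
    (f.map φ).hessianEval (φ u) (φ v) = φ (f.hessianEval u v) := by
  simp [hessianEval, hessP, hessQ, hessR, map, map_ofNat]

end CommRing

/-! ### Positive definiteness for `Disc > 0` (ordered fields) -/

section Ordered

variable {K : Type*} [Field K] [LinearOrder K] [IsStrictOrderedRing K] (f : BinaryCubic K)

/-- **`Disc f > 0 ⇒ P > 0`**: by the syzygy at `(1,0)` when `a ≠ 0` (`4P³ = (…)² + 27 Disc a² > 0`),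
and `P = b² > 0` when `a = 0` (then `Disc = b²(c² − 4bd)` forces `b ≠ 0`). [cite: BhargavaShankarTsimerman2012, §5.1; Davenport 1951 I (the Hessian of a form of positive discriminant is definite)] -/
theorem hessP_pos_of_disc_pos (h : 0 < f.disc) : 0 < f.hessP := by
  by_cases ha : f.a = 0
  · have hb : f.b ≠ 0 := by
      intro hb
      have : f.disc = 0 := by rw [disc_eq, ha, hb]; ring
      exact h.ne' this
    have : f.hessP = f.b ^ 2 := by rw [hessP, ha]; ring
    rw [this]
    positivity
  · have hs := f.syzygy_one_zero
    have h3 : 0 < 4 * f.hessP ^ 3 := by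
      rw [← sub_add_cancel (4 * f.hessP ^ 3) (27 * f.disc * f.a ^ 2), ← hs]
      have : 0 < 27 * f.disc * f.a ^ 2 := by positivity
      positivity
    have h3' : 0 < f.hessP ^ 3 := by linarith
    exact (Odd.pow_pos_iff (by decide : Odd 3)).mp h3'

/-- **Positive definiteness**: for `Disc f > 0` the Hessian is positive at every `(u, v) ≠ (0, 0)`. [cite: BhargavaShankarTsimerman2012, §5.1; Davenport 1951 I] -/
theorem hessianEval_pos_of_disc_pos (h : 0 < f.disc) {u v : K} (huv : (u, v) ≠ (0, 0)) : 0 < f.hessianEval u v := by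
  have hP := f.hessP_pos_of_disc_pos h
  have key := f.four_mul_hessP_mul_hessianEval u v
  by_cases hv : v = 0
  · have hu : u ≠ 0 := fun hu => huv (by rw [hu, hv])
    rw [hessianEval, hv]
    have : 0 < f.hessP * u ^ 2 := by positivity
    nlinarith
  · have : 0 < 3 * f.disc * v ^ 2 := by positivity
    have h4 : 0 < 4 * f.hessP * f.hessianEval u v := by rw [key]; positivity
    have : 0 < 4 * f.hessP := by positivity
    exact pos_of_mul_pos_right h4 this.le

end Ordered

/-! ### The root of the Hessian in the upper half plane (`ℝ`) -/

section Real

open Complex UpperHalfPlane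

variable (f : BinaryCubic ℝ)

/-- The complexified Hessian as a polynomial function `H(z, 1) = P z² + Q z + R` on `ℂ`. [folklore] -/
def hessianQuadℂ (z : ℂ) : ℂ := (f.hessP : ℂ) * z ^ 2 + (f.hessQ : ℂ) * z + (f.hessR : ℂ)

/-- Homogeneous complex evaluation: `H(z, w) = P z² + Q z w + R w²` equals `w² · H(z/w, 1)` for `w ≠ 0`. [folklore] -/
theorem hessianEval_map_ofReal_eq (z w : ℂ) (hw : w ≠ 0) :
    (f.map Complex.ofRealHom).hessianEval z w = w ^ 2 * f.hessianQuadℂ (z / w) := by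
  simp only [hessianEval, hessianQuadℂ, hessP, hessQ, hessR, map, Complex.ofRealHom_eq_coe, Complex.ofReal_sub,
    Complex.ofReal_mul, Complex.ofReal_pow, Complex.ofReal_ofNat]
  field_simp

/-- `H(z̄, 1) = conj H(z, 1)` (real coefficients). [folklore] -/
theorem hessianQuadℂ_conj (z : ℂ) : f.hessianQuadℂ (conj z) = conj (f.hessianQuadℂ z) := by
  simp [hessianQuadℂ, Complex.conj_ofReal]

/-- **The root of the Hessian in `ℍ`** for a real form of positive discriminant:
`z(f) = (−Q + i √(3 Disc f)) / (2P)` (`P > 0`, `4PR − Q² = 3 Disc > 0`). [cite: BhargavaShankarTsimerman2012, §5.1 (reduction theory); Davenport 1951 I (f is reduced iff its Hessian is reduced)] -/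
def hessianRoot (h : 0 < f.disc) : ℍ :=
  ⟨(-(f.hessQ : ℂ) + Complex.I * (Real.sqrt (3 * f.disc) : ℂ)) / ((2 * f.hessP : ℝ) : ℂ), by
    have hP := f.hessP_pos_of_disc_pos h
    have hs : 0 < Real.sqrt (3 * f.disc) := Real.sqrt_pos.mpr (by positivity)
    rw [Complex.div_ofReal_im]
    simp only [Complex.add_im, Complex.neg_im, Complex.ofReal_im, neg_zero, Complex.mul_im, Complex.I_re, zero_mul,
      Complex.I_im, Complex.ofReal_re, one_mul, zero_add]
    positivity⟩

/-- The coordinates of `hessianRoot`. [folklore] -/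
theorem coe_hessianRoot (h : 0 < f.disc) :
    ((f.hessianRoot h : ℍ) : ℂ) = (-(f.hessQ : ℂ) + Complex.I * (Real.sqrt (3 * f.disc) : ℂ)) / (2 * (f.hessP : ℂ)) := by
  change (-(f.hessQ : ℂ) + Complex.I * (Real.sqrt (3 * f.disc) : ℂ)) / ((2 * f.hessP : ℝ) : ℂ) = _
  push_cast
  rfl

/-- The imaginary part of `hessianRoot` is `√(3 Disc)/(2P)`. [folklore] -/
theorem im_hessianRoot (h : 0 < f.disc) : (f.hessianRoot h).im = Real.sqrt (3 * f.disc) / (2 * f.hessP) := by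
  rw [← UpperHalfPlane.coe_im]
  change ((-(f.hessQ : ℂ) + Complex.I * (Real.sqrt (3 * f.disc) : ℂ)) / ((2 * f.hessP : ℝ) : ℂ)).im = _
  rw [Complex.div_ofReal_im]
  simp only [Complex.add_im, Complex.neg_im, Complex.ofReal_im, neg_zero, Complex.mul_im, Complex.I_re, zero_mul,
    Complex.I_im, Complex.ofReal_re, one_mul, zero_add]

/-- The square of `s = i√(3 Disc)` is the discriminant `Q² − 4PR` of `H(z, 1)`. [folklore] -/
theorem I_mul_sqrt_sq (h : 0 < f.disc) :
    discrim (f.hessP : ℂ) f.hessQ f.hessR =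
      (Complex.I * (Real.sqrt (3 * f.disc) : ℂ)) * (Complex.I * (Real.sqrt (3 * f.disc) : ℂ)) := by
  have h1 : ((Real.sqrt (3 * f.disc) : ℝ) : ℂ) ^ 2 = 3 * (f.disc : ℂ) := by
    rw [← Complex.ofReal_pow, Real.sq_sqrt (by positivity)]; push_cast; ring
  have hrel : (f.hessQ : ℂ) ^ 2 - 4 * f.hessP * f.hessR = -3 * f.disc := by exact_mod_cast f.hessQ_sq_sub_four_mul
  rw [discrim]
  linear_combination hrel - Complex.I_sq * (3 * (f.disc : ℂ)) - Complex.I ^ 2 * h1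

/-- `hessianRoot` is a root of `H(z, 1)`. [folklore] -/
theorem hessianQuadℂ_hessianRoot (h : 0 < f.disc) : f.hessianQuadℂ (f.hessianRoot h) = 0 := by
  have hP : (f.hessP : ℂ) ≠ 0 := Complex.ofReal_ne_zero.mpr (f.hessP_pos_of_disc_pos h).ne'
  have key := (quadratic_eq_zero_iff hP (f.I_mul_sqrt_sq h) ((f.hessianRoot h : ℍ) : ℂ)).mpr (Or.inl (f.coe_hessianRoot h))
  rw [hessianQuadℂ]
  linear_combination key

/-- **Uniqueness**: a point of `ℍ` where `H(z, 1)` vanishes is `hessianRoot` (the other root is its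
complex conjugate, in the lower half plane). [folklore] -/
theorem eq_hessianRoot_of_root (h : 0 < f.disc) {w : ℍ} (hw : f.hessianQuadℂ w = 0) : w = f.hessianRoot h := by
  have hP0 := f.hessP_pos_of_disc_pos h
  have hP : (f.hessP : ℂ) ≠ 0 := Complex.ofReal_ne_zero.mpr hP0.ne'
  have hquad : (f.hessP : ℂ) * ((w : ℂ) * (w : ℂ)) + f.hessQ * (w : ℂ) + f.hessR = 0 := by
    rw [← hw, hessianQuadℂ]; ring
  rcases (quadratic_eq_zero_iff hP (f.I_mul_sqrt_sq h) (w : ℂ)).mp hquad with hroot | hroot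
  · exact UpperHalfPlane.ext (by rw [hroot, coe_hessianRoot])
  · -- the conjugate root has negative imaginary part
    exfalso
    have him : ((w : ℂ)).im = -(Real.sqrt (3 * f.disc) / (2 * f.hessP)) := by
      rw [hroot, show (2 * (f.hessP : ℂ)) = ((2 * f.hessP : ℝ) : ℂ) by push_cast; rfl, Complex.div_ofReal_im]
      simp only [Complex.sub_im, Complex.neg_im, Complex.ofReal_im, neg_zero, Complex.mul_im, Complex.I_re, zero_mul,
        Complex.I_im, Complex.ofReal_re, one_mul, zero_add, zero_sub, neg_div]
    have hpos : 0 < Real.sqrt (3 * f.disc) / (2 * f.hessP) := by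
      have := Real.sqrt_pos.mpr (show 0 < 3 * f.disc by positivity); positivity
    have := w.im_pos
    rw [← UpperHalfPlane.coe_im, him] at this
    linarith

/-- The discriminant of `f ∘ γ` is positive when that of `f` is (`Disc(f ∘ γ) = (det γ)⁶ Disc f`). [folklore] -/
theorem disc_subst_pos {γ : Matrix (Fin 2) (Fin 2) ℝ} (hγ : γ.det ≠ 0) (h : 0 < f.disc) : 0 < (f.subst γ).disc := by
  rw [disc_subst]
  have : 0 < γ.det ^ 6 := by positivity
  positivity

/-- The substitution identity for `H(z,1)` under a Möbius change of variable: for real `γ` and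
`z ∈ ℂ` with `γ₀₁ z + γ₁₁ ≠ 0`,
`H(f ∘ γ)(z, 1) = (det γ)² (γ₀₁ z + γ₁₁)² · H(f)((γ₀₀ z + γ₁₀)/(γ₀₁ z + γ₁₁), 1)`. [folklore] -/
theorem hessianQuadℂ_subst (γ : Matrix (Fin 2) (Fin 2) ℝ) (z : ℂ) (hden : (γ 0 1 : ℂ) * z + γ 1 1 ≠ 0) :
    (f.subst γ).hessianQuadℂ z =
      (γ.det : ℂ) ^ 2 * ((γ 0 1 : ℂ) * z + γ 1 1) ^ 2 *
        f.hessianQuadℂ (((γ 0 0 : ℂ) * z + γ 1 0) / ((γ 0 1 : ℂ) * z + γ 1 1)) := by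
  -- complexify the covariance identity and dehomogenise
  have h1 : (f.subst γ).hessianQuadℂ z = ((f.subst γ).map Complex.ofRealHom).hessianEval z 1 := by
    rw [hessianEval_map_ofReal_eq _ z 1 one_ne_zero, one_pow, one_mul, div_one]
  have h2 : ((f.subst γ).map Complex.ofRealHom).hessianEval z 1 =
      (γ.map Complex.ofRealHom).det ^ 2 * (f.map Complex.ofRealHom).hessianEval
        (z * (γ.map Complex.ofRealHom) 0 0 + 1 * (γ.map Complex.ofRealHom) 1 0)
        (z * (γ.map Complex.ofRealHom) 0 1 + 1 * (γ.map Complex.ofRealHom) 1 1) := by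
    rw [map_subst, hessianEval_subst]
  rw [h1, h2, hessianEval_map_ofReal_eq f _ _ (by simpa [mul_comm] using hden)]
  have hdet : (γ.map Complex.ofRealHom).det = (γ.det : ℂ) := by
    rw [← RingHom.mapMatrix_apply, ← RingHom.map_det]; rfl
  simp only [hdet, Matrix.map_apply, Complex.ofRealHom_eq_coe, one_mul]
  ring_nf

/-- **Equivariance of the root of the Hessian.** For `γ ∈ GL₂(ℝ)` and `Disc f > 0`:
`γᵀ • z(f ∘ γ) = z(f)` for Mathlib's action of `GL(2, ℝ)` on `ℍ` (Möbius transformation, composed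
with complex conjugation when `det γ < 0`); i.e. `z(f ∘ γ) = (γᵀ)⁻¹ • z(f)`, so `z : V⁽⁰⁾_ℝ → ℍ`
intertwines the substitution action with the modular action. [cite: BhargavaShankarTsimerman2012, §5.1; Davenport 1951 I] -/
theorem smul_hessianRoot_subst {γ : Matrix (Fin 2) (Fin 2) ℝ} (hγ : γ.det ≠ 0) (h : 0 < f.disc) :
    Matrix.GeneralLinearGroup.mkOfDetNeZero γ.transpose (by rwa [Matrix.det_transpose]) • (f.subst γ).hessianRoot
        (f.disc_subst_pos hγ h) = f.hessianRoot h := by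
  set g : GL (Fin 2) ℝ := Matrix.GeneralLinearGroup.mkOfDetNeZero γ.transpose (by rwa [Matrix.det_transpose]) with hg
  set w : ℍ := (f.subst γ).hessianRoot (f.disc_subst_pos hγ h) with hw
  refine f.eq_hessianRoot_of_root h ?_
  -- `↑(g • w) = σ_g (num / denom)` and `H(f)` has real coefficients
  have hg00 : (g : Matrix (Fin 2) (Fin 2) ℝ) 0 0 = γ 0 0 := rfl
  have hg01 : (g : Matrix (Fin 2) (Fin 2) ℝ) 0 1 = γ 1 0 := rfl
  have hg10 : (g : Matrix (Fin 2) (Fin 2) ℝ) 1 0 = γ 0 1 := rfl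
  have hg11 : (g : Matrix (Fin 2) (Fin 2) ℝ) 1 1 = γ 1 1 := rfl
  have hden : (γ 0 1 : ℂ) * (w : ℂ) + γ 1 1 ≠ 0 := by
    have := UpperHalfPlane.denom_ne_zero g w
    rwa [UpperHalfPlane.denom, hg10, hg11] at this
  have hroot : f.hessianQuadℂ (((γ 0 0 : ℂ) * w + γ 1 0) / ((γ 0 1 : ℂ) * w + γ 1 1)) = 0 := by
    have h0 := (f.subst γ).hessianQuadℂ_hessianRoot (f.disc_subst_pos hγ h)
    rw [← hw, f.hessianQuadℂ_subst γ w hden] at h0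
    have hdet : (γ.det : ℂ) ^ 2 * ((γ 0 1 : ℂ) * w + γ 1 1) ^ 2 ≠ 0 :=
      mul_ne_zero (pow_ne_zero _ (Complex.ofReal_ne_zero.mpr hγ)) (pow_ne_zero _ hden)
    exact (mul_eq_zero.mp h0).resolve_left hdet
  have hnumden : UpperHalfPlane.num g w / UpperHalfPlane.denom g w =
      ((γ 0 0 : ℂ) * w + γ 1 0) / ((γ 0 1 : ℂ) * w + γ 1 1) := by
    rw [UpperHalfPlane.num, UpperHalfPlane.denom, hg00, hg01, hg10, hg11]
  rw [UpperHalfPlane.coe_smul, hnumden, UpperHalfPlane.σ]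
  split_ifs
  · simpa using hroot
  · change f.hessianQuadℂ (conj _) = 0
    rw [hessianQuadℂ_conj, hroot, map_zero]

end Real

end BinaryCubic

end Literature.NumberTheory.CubicFields

end
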